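import Mathlib

/-!
# The flag-sum certificate at `n = 3` (THEOREM N3 of DENSITY-XY G.60): analytic cores  [folklore]

Kernel anchors for ADDENDUM G.60(a) of `DENSITY-XY.md` (repair cell b2b-imbrie, seat 2, K-line).
For a three-point probability measure `μ = ∑ wᵢ δ_{xᵢ}` with Jacobi parameters `b₁, b₂ ≤ 1`
(equivalently `V := Var μ ≤ 1` and `D₃ := w₁w₂w₃ ∏(xᵢ-xⱼ)² ≤ V²`), THEOREM N3 says that the
flag sum `Z♮ = ∑_{σ ∈ S₃} ∏ₖ min(1, 4 ûₖ/ûₖ₊₁)` of the tempered level ratios is `≥ 1`.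
The hand proof in G.60(a) reduces this to two elementary real inequalities, which are the content
of this file:

* `two_child_sum_ge_one` — CASE A (a dominant atom, `w₁ ≥ ½`): for `p + q = 1`, `0 < β ≤ 2`,
  `min(1, 4p²/β) + min(1, 4q²/β) ≥ 1` (the full two-child `n = 2` inequality for the dominant
  atom's Christoffel cloud, the dilation `β ≤ 1/w₁ ≤ 2` being absorbed by the spare factor);
* `lemmaBprime` — CASE B (all weights `< ½`): with `φ_w(ξ) := min(1, 4ξ²/w, 4w²/ξ)` (`phiN3`),
  weights `w₁ ≥ w₂ ≥ w₃ > 0`, `∑ w = 1`, `w₁ < ½`, and normalised pair energies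
  `ξ₁₂ + ξ₁₃ + ξ₂₃ = 1` obeying the COLLINEARITY (parallel-axis) constraints `ξᵢⱼ + ξᵢₖ ≥ wᵢ`,
  one has `φ_{w₁}(ξ₁₂) + φ_{w₁}(ξ₁₃) + φ_{w₂}(ξ₁₂) + φ_{w₂}(ξ₂₃) ≥ 1`.

The reduction of the six flag terms to these two statements (identities (N.0)–(N.1) and the crude
bound (B.i) of G.60(a)) is not formalised here.  Elementary real algebra only; nothing in this file
asserts CONJECTURE K, F♮ for `n ≥ 4`, LLA, or anything about the interacting chain.
-/

namespace Literature.MathematicalPhysics.QuantumLattice.Imbrie2016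

noncomputable section

/-- [folklore] The crude one-flag certificate of G.60 (B.i): `φ_w(ξ) = min(1, 4ξ²/w, 4w²/ξ)`. -/
def phiN3 (w ξ : ℝ) : ℝ := min 1 (min (4 * ξ ^ 2 / w) (4 * w ^ 2 / ξ))

/-- [folklore] `φ_w(ξ) ≥ 0` for `w, ξ > 0`. -/
theorem phiN3_nonneg {w ξ : ℝ} (hw : 0 < w) (hξ : 0 < ξ) : 0 ≤ phiN3 w ξ := by
  unfold phiN3
  refine le_min zero_le_one (le_min ?_ ?_) <;> positivity

/-- [folklore] A common lower bound of the three entries bounds `φ` from below. -/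
theorem le_phiN3 {w ξ L : ℝ} (h1 : L ≤ 1) (h2 : L ≤ 4 * ξ ^ 2 / w) (h3 : L ≤ 4 * w ^ 2 / ξ) :
    L ≤ phiN3 w ξ := le_min h1 (le_min h2 h3)

/-- [folklore] Division-free lower-bound certificate for `phiN3`. -/
theorem le_phiN3_of_mul {w ξ L : ℝ} (hw : 0 < w) (hξ : 0 < ξ) (h1 : L ≤ 1)
    (h2 : L * w ≤ 4 * ξ ^ 2) (h3 : L * ξ ≤ 4 * w ^ 2) : L ≤ phiN3 w ξ :=
  le_phiN3 h1 (by rwa [le_div_iff₀ hw]) (by rwa [le_div_iff₀ hξ])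

/-- [folklore] Large `ξ`: `φ_w(ξ) ≥ 4w²/ξ` when `4w² ≤ ξ` and `w ≤ ξ`. -/
theorem phiN3_ge_large {w ξ : ℝ} (hw : 0 < w) (hξ : 0 < ξ) (h1 : 4 * w ^ 2 ≤ ξ) (h2 : w ≤ ξ) :
    4 * w ^ 2 / ξ ≤ phiN3 w ξ := by
  refine le_phiN3_of_mul hw hξ ?_ ?_ ?_
  · rw [div_le_one hξ]; exact h1
  · rw [div_mul_eq_mul_div, div_le_iff₀ hξ]
    have : w ^ 3 ≤ ξ ^ 3 := by gcongr
    nlinarith [this]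
  · rw [div_mul_cancel₀ _ hξ.ne']

/-- [folklore] Small `ξ`: `φ_w(ξ) ≥ 4ξ²/w` when `4ξ² ≤ w` and `ξ ≤ w`. -/
theorem phiN3_ge_small {w ξ : ℝ} (hw : 0 < w) (hξ : 0 < ξ) (h1 : 4 * ξ ^ 2 ≤ w) (h2 : ξ ≤ w) :
    4 * ξ ^ 2 / w ≤ phiN3 w ξ := by
  refine le_phiN3_of_mul hw hξ ?_ ?_ ?_
  · rw [div_le_one hw]; exact h1
  · rw [div_mul_cancel₀ _ hw.ne']
  · rw [div_mul_eq_mul_div, div_le_iff₀ hw]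
    have : ξ ^ 3 ≤ w ^ 3 := by gcongr
    nlinarith [this]

/-- [folklore] **CASE A core (two children of a dominant atom).**  If `p, q ≥ 0`, `p + q = 1` and
`0 < β ≤ 2` then `min(1, 4p²/β) + min(1, 4q²/β) ≥ 1`. -/
theorem two_child_sum_ge_one (p q β : ℝ) (hp : 0 ≤ p) (hq : 0 ≤ q) (hpq : p + q = 1)
    (hβ : 0 < β) (hβ2 : β ≤ 2) :
    1 ≤ min 1 (4 * p ^ 2 / β) + min 1 (4 * q ^ 2 / β) := by
  have hp2 : 2 * p ^ 2 ≤ 4 * p ^ 2 / β := by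
    rw [le_div_iff₀ hβ]; nlinarith [sq_nonneg p]
  have hq2 : 2 * q ^ 2 ≤ 4 * q ^ 2 / β := by
    rw [le_div_iff₀ hβ]; nlinarith [sq_nonneg q]
  have m1 : min 1 (2 * p ^ 2) ≤ min 1 (4 * p ^ 2 / β) := min_le_min le_rfl hp2
  have m2 : min 1 (2 * q ^ 2) ≤ min 1 (4 * q ^ 2 / β) := min_le_min le_rfl hq2
  have key : 1 ≤ min 1 (2 * p ^ 2) + min 1 (2 * q ^ 2) := by
    rcases le_total 1 (2 * p ^ 2) with h | h
    · rw [min_eq_left h]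
      have : (0:ℝ) ≤ min 1 (2 * q ^ 2) := le_min zero_le_one (by positivity)
      linarith
    · rw [min_eq_right h]
      rcases le_total 1 (2 * q ^ 2) with h' | h'
      · rw [min_eq_left h']; nlinarith [sq_nonneg p]
      · rw [min_eq_right h']; nlinarith [sq_nonneg (p - q)]
  linarith

/-! ### small nonlinear facts used in CASE B (kept outside the main proof to keep `nlinarith` cheap) -/

/-- [folklore] `w ≤ 4w²` for `w ≥ 1/4`. -/
theorem n3aux_le_four_sq {w : ℝ} (h : 1 / 4 ≤ w) : w ≤ 4 * w ^ 2 := by nlinarith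

/-- [folklore] `4a² < w`, `w ≥ 1/4`, `a > 0` give `a ≤ w`. -/
theorem n3aux_le_of_sq_small {a w : ℝ} (ha : 0 < a) (hw : 1 / 4 ≤ w) (h : 4 * a ^ 2 < w) :
    a ≤ w := by nlinarith

/-- [folklore] `4a², 4b² < w < 1/2` give `a + b < 3/4` (indeed `< √w ≤ 1/√2`). -/
theorem n3aux_sum_lt {a b w : ℝ} (ha : 0 < a) (hb : 0 < b) (h1 : 4 * a ^ 2 < w)
    (h2 : 4 * b ^ 2 < w) (h3 : w < 1 / 2) : a + b < 3 / 4 := by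
  nlinarith [sq_nonneg (a - b)]

/-- [folklore] AM–GM: `(1 - 2w) w ≤ 1/8`. -/
theorem n3aux_amgm {w : ℝ} : (1 - 2 * w) * w ≤ 1 / 8 := by nlinarith [sq_nonneg (4 * w - 1)]

/-- [folklore] **LEMMA B′ (CASE B of THEOREM N3, DENSITY-XY G.60(a2)).**  Here `a = ξ₁₂`,
`b = ξ₁₃`, `c = ξ₂₃` are the normalised pair energies `Xᵢⱼ/V`, and `c1, c2, c3` are the collinearity
(parallel-axis) constraints `ξᵢⱼ + ξᵢₖ ≥ wᵢ`. -/
theorem lemmaBprime (w1 w2 w3 a b c : ℝ)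
    (h32 : w3 ≤ w2) (h21 : w2 ≤ w1) (h3 : 0 < w3) (hsum : w1 + w2 + w3 = 1) (hhalf : w1 < 1 / 2)
    (ha : 0 < a) (hb : 0 < b) (hc : 0 < c) (habc : a + b + c = 1)
    (c1 : w1 ≤ a + b) (c2 : w2 ≤ a + c) (c3 : w3 ≤ b + c) :
    1 ≤ phiN3 w1 a + phiN3 w1 b + phiN3 w2 a + phiN3 w2 c := by
  have hw2 : 0 < w2 := lt_of_lt_of_le h3 h32
  have hw1 : 0 < w1 := lt_of_lt_of_le hw2 h21
  have hw1t : 1 / 3 ≤ w1 := by linarith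
  have hw1q : 1 / 4 ≤ w1 := by linarith
  have hw2q : 1 / 4 < w2 := by linarith
  have n1a := phiN3_nonneg hw1 ha
  have n1b := phiN3_nonneg hw1 hb
  have n2a := phiN3_nonneg hw2 ha
  have n2c := phiN3_nonneg hw2 hc
  have h4w1 : w1 ≤ 4 * w1 ^ 2 := n3aux_le_four_sq hw1q
  have h4w2 : w2 ≤ 4 * w2 ^ 2 := n3aux_le_four_sq hw2q.le
  have hsq21 : w2 ^ 2 ≤ w1 ^ 2 := by gcongr
  have hsq1 : (1 / 3 : ℝ) ^ 2 ≤ w1 ^ 2 := by gcongr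
  by_cases hA : w1 ≤ 4 * a ^ 2
  · -- case (1): ξ₁₂ ≥ θ
    by_cases hA' : a ≤ 4 * w1 ^ 2
    · -- (1a): φ_{w1}(a) = 1
      have f := le_phiN3_of_mul hw1 ha le_rfl (by linarith) (by linarith)
      linarith
    · -- (1b): a > 4 w1²
      have hA'' : 4 * w1 ^ 2 ≤ a := le_of_not_ge hA'
      have haw1 : w1 ≤ a := le_trans h4w1 hA''
      have haw2 : w2 ≤ a := le_trans h21 haw1
      have f1 := phiN3_ge_large hw1 ha hA'' haw1
      have f2 := phiN3_ge_large hw2 ha (by linarith) haw2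
      have hale : a ≤ w1 + w2 := by linarith
      have key : 1 ≤ (4 * w1 ^ 2 + 4 * w2 ^ 2) / a := by
        rw [le_div_iff₀ ha]; linarith
      rw [add_div] at key
      linarith
  · -- case (2): 4ξ₁₂² < w1
    have hA2 : 4 * a ^ 2 < w1 := lt_of_not_ge hA
    by_cases hB : w1 ≤ 4 * b ^ 2
    · by_cases hB' : b ≤ 4 * w1 ^ 2
      · -- (2a): φ_{w1}(b) = 1
        have f := le_phiN3_of_mul hw1 hb le_rfl (by linarith) (by linarith)
        linarith
      · -- (2b): b > 4 w1²
        have hB'' : 4 * w1 ^ 2 ≤ b := le_of_not_ge hB'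
        have hbw1 : w1 ≤ b := le_trans h4w1 hB''
        have f1 := phiN3_ge_large hw1 hb hB'' hbw1
        have hb' : b ≤ 1 - w2 := by linarith
        have hs : a + c < 5 / 9 := by nlinarith [hsq1]
        -- the larger of ξ₁₂, ξ₂₃ certifies φ_{w2} ≥ w2
        have fM : w2 ≤ phiN3 w2 a + phiN3 w2 c := by
          rcases le_total c a with hca | hac
          · have h2a : w2 ≤ 2 * a := by linarith
            have e1 : w2 * w2 ≤ (2 * a) * (2 * a) := mul_self_le_mul_self hw2.le h2a
            have e2 : w2 * a ≤ w2 * (4 * w2) :=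
              mul_le_mul_of_nonneg_left (by linarith) hw2.le
            have : w2 ≤ phiN3 w2 a := le_phiN3_of_mul hw2 ha (by linarith) (by linarith) (by linarith)
            linarith
          · have h2c : w2 ≤ 2 * c := by linarith
            have e1 : w2 * w2 ≤ (2 * c) * (2 * c) := mul_self_le_mul_self hw2.le h2c
            have e2 : w2 * c ≤ w2 * (4 * w2) :=
              mul_le_mul_of_nonneg_left (by linarith) hw2.le
            have : w2 ≤ phiN3 w2 c := le_phiN3_of_mul hw2 hc (by linarith) (by linarith) (by linarith)
            linarith
        have key : 1 - w2 ≤ 4 * w1 ^ 2 / b := by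
          rw [le_div_iff₀ hb]
          have e1 : (1 - w2) * b ≤ (1 - w2) * (1 - w2) :=
            mul_le_mul_of_nonneg_left hb' (by linarith)
          have e2 : (1 - w2) * (1 - w2) ≤ (2 * w1) * (2 * w1) :=
            mul_self_le_mul_self (by linarith) (by linarith)
          linarith
        linarith
    · -- (2c): 4ξ₁₂² < w1 and 4ξ₁₃² < w1
      have hB2 : 4 * b ^ 2 < w1 := lt_of_not_ge hB
      have haw : a ≤ w1 := n3aux_le_of_sq_small ha hw1q hA2
      have hbw : b ≤ w1 := n3aux_le_of_sq_small hb hw1q hB2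
      have f1 := phiN3_ge_small hw1 ha hA2.le haw
      have f2 := phiN3_ge_small hw1 hb hB2.le hbw
      have sum12 : 2 * w1 ≤ (4 * a ^ 2 + 4 * b ^ 2) / w1 := by
        rw [le_div_iff₀ hw1]
        have e1 : w1 * w1 ≤ (a + b) * (a + b) := mul_self_le_mul_self hw1.le c1
        have e2 : 0 ≤ (a - b) ^ 2 := sq_nonneg _
        nlinarith [e1, e2]
      rw [add_div] at sum12
      have hs : a + b < 3 / 4 := n3aux_sum_lt ha hb hA2 hB2 hhalf
      have hcq : 1 / 4 < c := by linarith
      have hcle : c ≤ 1 - w1 := by linarith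
      have f3 : 1 - 2 * w1 ≤ phiN3 w2 c := by
        refine le_phiN3_of_mul hw2 hc (by linarith) ?_ ?_
        · have e1 : (1 - 2 * w1) * w2 ≤ (1 - 2 * w1) * w1 :=
            mul_le_mul_of_nonneg_left h21 (by linarith)
          have e2 : (1 - 2 * w1) * w1 ≤ 1 / 8 := n3aux_amgm
          have e3 : (1 / 4 : ℝ) * (1 / 4) < c * c := mul_lt_mul'' hcq hcq (by norm_num) (by norm_num)
          nlinarith [e1, e2, e3]
        · have e4 : (1 - 2 * w1) * c ≤ (1 - 2 * w1) * (1 - w1) :=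
            mul_le_mul_of_nonneg_left hcle (by linarith)
          have e5 : (1 - 2 * w1) * (1 - w1) ≤ (1 - w1) * (1 - w1) :=
            mul_le_mul_of_nonneg_right (by linarith) (by linarith)
          have e6 : (1 - w1) * (1 - w1) ≤ (2 * w2) * (2 * w2) :=
            mul_self_le_mul_self (by linarith) (by linarith)
          nlinarith [e4, e5, e6]
      linarith

end

end Literature.MathematicalPhysics.QuantumLattice.Imbrie2016
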